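import Mathlib
import Summits.MatrixMultiplication.MatrixMultiplication.Theses.LevelGradedCohnUmans
import Summits.MatrixMultiplication.MatrixMultiplication.Theorems.LevelGradedCohnUmansGradedPricingStubSupport
import Summits.MatrixMultiplication.MatrixMultiplication.Theorems.LevelGradedCohnUmansGradedPricingStubExpansion
import Literature.RepresentationTheory.FiniteGroups.WedderburnBlocks
import Literature.Computability.AlgebraicComplexity.BCGPUInfiniteGroupsProofs

/-!
# `GradedPricing` — graded Cohn–Umans pricing of a separated triple (crux `stmt-MatrixMultiplication-7611`)

Route `LevelGradedCohnUmans`, crux `GradedPricing` (rank 2), line `fourier-support-repfun`: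

  for every finite group `G`, every BI-INVARIANT subspace `J ≤ ℂ^G` and every `J`-SEPARATED triple
  `X, Y, Z ⊆ G` (words `x⁻¹ y y'⁻¹ z`, Kronecker pattern),
  `(|X||Y||Z|)^(ω/3) ≤ Σᶠ_{χ ∈ Irr(G) ∩ J} χ(1)^ω`   (`ω = omega ℂ`)

— the finite-group `R_sep` form of Blasiak–Cohn–Grochow–Pratt–Umans 2024, Thm 2.2.

Proof (line `fourier-support-repfun`; the two registered stubs are the landed helper files
`LevelGradedCohnUmansGradedPricingStubSupport` / `…StubExpansion`).  Fix a Wedderburn isomorphism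
`φ : ℂ[G] ≃ₐ ∏ᵢ ℂ^{dᵢ×dᵢ}` (`exists_algEquiv_pi_matrix`).
* `le_repFun_charSupport` (the transfer `C⁺`, Peter–Weyl containment): a bi-invariant `J` consists
  of representative functions of the blocks whose characters it contains,
  `J ≤ repFun {i : χᵢ ∈ J}` — from `stub_support` (contrapositively: `χᵢ ∉ J ⟹ φ(f̌)ᵢ = 0` for
  `f ∈ J`) and `stub_expansion`.
* `sep_inv_dictionary`: a `J`-separated triple with `Y ≠ ∅` yields, for the inverted triple
  `(X⁻¹, Y⁻¹, Z⁻¹)`, the embedding-form TPP and a BCGPU separating family (Def. 2.1) drawn from `J`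
  (consumes BOTH halves of the separation pattern).
* `sum_charSupport_rpow_le`: `Σ_{χᵢ ∈ J} dᵢ^s ≤ Σᶠ_{χ ∈ Irr(G) ∩ J} χ(1)^s` (distinct irreducible
  block characters, non-negative terms).
* `GradedPricing_of`: zero volume is `0 ≤ Σᶠ`; otherwise `Y ≠ ∅` and the tree's PROVED
  `BCGPU2024_thm_2_2_corrected_holds` (BCGPU 2024 Thm 2.2, embedding TPP) applied to
  `(X⁻¹, Y⁻¹, Z⁻¹)` with `R_sep := {i // χᵢ ∈ J}`, `Finset.card_inv`, and the budget comparison at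
  `s = ω` conclude `…Theses.LevelGradedCohnUmans.GradedPricing` by name.

Disproof obligations (cdisprove cycle 1, `Theorems/GradedPricing/Negative/*`): bi-invariance is used
only in `stub_support`, two-sidedly (`gradedPricing_false_without_biInv`,
`gradedPricing_false_with_leftInv_only`); both pattern halves are hypotheses of `sep_inv_dictionary`
(`gradedPricing_false_without_ones` / `_zeros`); the inequality is `≤` with constant `1`
(`gradedPricing_attained`, `not_gradedPricing_strict`).
-/

set_option linter.dupNamespace false

noncomputable section

namespace Summit.MatrixMultiplication.MatrixMultiplication.Theorems.GradedPricing

open scoped BigOperators Classical Pointwise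
open Literature.RepresentationTheory.FiniteGroups Literature.Computability.AlgebraicComplexity

variable {G : Type} [Group G]
variable {r : ℕ} {d : Fin r → ℕ}

/-! ## Dictionary and budget -/

/-- **The inversion dictionary.** A `J`-separated triple (route convention: words `x⁻¹ y y'⁻¹ z`,
Kronecker pattern, BOTH halves) with `Y ≠ ∅` yields, for the inverted triple `(X⁻¹, Y⁻¹, Z⁻¹)`,
the embedding-form TPP and a BCGPU separating family (Def. 2.1) drawn from `J`
(`f'_{x',z'} := f_{x'⁻¹, z'⁻¹}`; the value `1` at `x' z'⁻¹ = x⁻¹·y₀·y₀⁻¹·z` needs some `y₀ ∈ Y`). -/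
theorem sep_inv_dictionary (J : Submodule ℂ (G → ℂ)) (X Y Z : Finset G) (hY : Y.Nonempty)
    (hsep : ∀ x₀ ∈ X, ∀ z₀ ∈ Z, ∃ f ∈ J, ∀ x ∈ X, ∀ y ∈ Y, ∀ y' ∈ Y, ∀ z ∈ Z,
      (x = x₀ ∧ y = y' ∧ z = z₀ → f (x⁻¹ * y * y'⁻¹ * z) = 1) ∧
      (¬ (x = x₀ ∧ y = y' ∧ z = z₀) → f (x⁻¹ * y * y'⁻¹ * z) = 0)) :
    (∀ x ∈ X⁻¹, ∀ x' ∈ X⁻¹, ∀ y ∈ Y⁻¹, ∀ y' ∈ Y⁻¹, ∀ z ∈ Z⁻¹, ∀ z' ∈ Z⁻¹,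
      x * y⁻¹ * y' * z⁻¹ = x' * z'⁻¹ → x = x' ∧ y = y' ∧ z = z') ∧
    ∃ f : G → G → (G → ℂ),
      Literature.Computability.AlgebraicComplexity.IsSeparatingFamily X⁻¹ Y⁻¹ Z⁻¹ f ∧
      ∀ x ∈ X⁻¹, ∀ z ∈ Z⁻¹, f x z ∈ J := by
  obtain ⟨y₀, hy₀⟩ := hY
  have memX : ∀ {x : G}, x ∈ X⁻¹ → x⁻¹ ∈ X := fun h => Finset.mem_inv'.1 h
  have memY : ∀ {y : G}, y ∈ Y⁻¹ → y⁻¹ ∈ Y := fun h => Finset.mem_inv'.1 h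
  have memZ : ∀ {z : G}, z ∈ Z⁻¹ → z⁻¹ ∈ Z := fun h => Finset.mem_inv'.1 h
  constructor
  · -- embedding-form TPP for `(X⁻¹, Y⁻¹, Z⁻¹)` from separation (value `0` off the pattern)
    intro x hx x' hx' y hy y' hy' z hz z' hz' he
    obtain ⟨f, -, hf⟩ := hsep x'⁻¹ (memX hx') z'⁻¹ (memZ hz')
    have h1 : f (x'⁻¹⁻¹ * y₀ * y₀⁻¹ * z'⁻¹) = 1 :=
      (hf _ (memX hx') _ hy₀ _ hy₀ _ (memZ hz')).1 ⟨rfl, rfl, rfl⟩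
    have e1 : x'⁻¹⁻¹ * y₀ * y₀⁻¹ * z'⁻¹ = x' * z'⁻¹ := by group
    by_contra hne
    have h0 : f (x⁻¹⁻¹ * y⁻¹ * y'⁻¹⁻¹ * z⁻¹) = 0 :=
      (hf _ (memX hx) _ (memY hy) _ (memY hy') _ (memZ hz)).2
        (fun ⟨h1', h2', h3'⟩ => hne ⟨inv_injective h1', inv_injective h2', inv_injective h3'⟩)
    have e0 : x⁻¹⁻¹ * y⁻¹ * y'⁻¹⁻¹ * z⁻¹ = x * y⁻¹ * y' * z⁻¹ := by simp only [inv_inv]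
    rw [e0, he, ← e1, h1] at h0
    exact one_ne_zero h0
  · -- the separating family, drawn from `J` (value `1` on the pattern needs `y₀ ∈ Y`)
    choose! fsep hfsepJ hfsep using hsep
    refine ⟨fun x z => fsep x⁻¹ z⁻¹, ?_, ?_⟩
    · intro x hx z hz
      have hf := hfsep x⁻¹ (memX hx) z⁻¹ (memZ hz)
      refine ⟨?_, ?_⟩
      · have h1 := (hf _ (memX hx) _ hy₀ _ hy₀ _ (memZ hz)).1 ⟨rfl, rfl, rfl⟩
        have e1 : x⁻¹⁻¹ * y₀ * y₀⁻¹ * z⁻¹ = x * z⁻¹ := by group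
        rwa [e1] at h1
      · intro x' hx' y hy y' hy' z' hz' hne
        have h0 := (hf _ (memX hx') _ (memY hy) _ (memY hy') _ (memZ hz')).2 (by
          rintro ⟨h1', h2', h3'⟩
          apply hne
          have ex : x' = x := inv_injective h1'
          have ey : y = y' := inv_injective h2'
          have ez : z' = z := inv_injective h3'
          subst ex; subst ey; subst ez
          group)
        have e0 : x'⁻¹⁻¹ * y⁻¹ * y'⁻¹⁻¹ * z'⁻¹ = x' * y⁻¹ * y' * z'⁻¹ := by simp only [inv_inv]
        rwa [e0] at h0
    · intro x hx z hz
      exact hfsepJ x⁻¹ (memX hx) z⁻¹ (memZ hz)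

/-- **Budget comparison.** The blocks whose character lies in `J` have pairwise distinct irreducible
characters (`character_blockRep_injective`, `isIrreducible_blockRep`) in the finite set
`Irr(G) ∩ J` (`irrChars_finite_holds`), of degrees `dᵢ = χᵢ(1)` (`Representation.char_one`); all
terms are `≥ 0` (`IsIrrChar.exists_apply_one`). -/
theorem sum_charSupport_rpow_le [Fintype G] [∀ i, NeZero (d i)]
    (φ : MonoidAlgebra ℂ G ≃ₐ[ℂ] Literature.RepresentationTheory.FiniteGroups.BlockAlgebraC d)
    (J : Submodule ℂ (G → ℂ)) (s : ℝ) :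
    ∑ i : {i : Fin r // (Literature.RepresentationTheory.FiniteGroups.blockRep φ i).character ∈ J},
        (d i.1 : ℝ) ^ s ≤
      ∑ᶠ χ ∈ Literature.RepresentationTheory.FiniteGroups.irrChars G ∩ (J : Set (G → ℂ)),
        (χ 1).re ^ s := by
  have hfin : (irrChars G ∩ (J : Set (G → ℂ))).Finite :=
    (irrChars_finite_holds G).subset Set.inter_subset_left
  rw [finsum_mem_eq_finite_toFinset_sum _ hfin]
  set χ : {i : Fin r // (blockRep φ i).character ∈ J} → (G → ℂ) :=
    fun i => (blockRep φ i.1).character with hχ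
  have hinj : Function.Injective χ := fun i j h =>
    Subtype.ext (character_blockRep_injective φ h)
  have hmem : ∀ i, χ i ∈ irrChars G ∩ (J : Set (G → ℂ)) := fun i =>
    ⟨⟨Fin (d i.1) → ℂ, inferInstance, inferInstance, inferInstance, blockRep φ i.1,
      isIrreducible_blockRep φ i.1, rfl⟩, i.2⟩
  have hdeg : ∀ i, ((χ i 1).re : ℝ) = d i.1 := fun i => by
    simp [hχ, Representation.char_one]
  have h1 : ∑ i : {i : Fin r // (blockRep φ i).character ∈ J}, (d i.1 : ℝ) ^ s =
      ∑ ψ ∈ Finset.univ.image χ, (ψ 1).re ^ s := by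
    rw [Finset.sum_image fun i _ j _ h => hinj h]
    exact Finset.sum_congr rfl fun i _ => by rw [hdeg]
  rw [h1]
  refine Finset.sum_le_sum_of_subset_of_nonneg ?_ fun ψ hψ _ => ?_
  · intro ψ hψ
    rw [Finset.mem_image] at hψ
    obtain ⟨i, _, rfl⟩ := hψ
    exact hfin.mem_toFinset.2 (hmem i)
  · obtain ⟨n, -, hn⟩ := IsIrrChar.exists_apply_one (hfin.mem_toFinset.1 hψ).1
    rw [hn]
    exact Real.rpow_nonneg (by simp) _

/-! ## The transfer `C⁺` and the composition -/

/-- **Transfer `C⁺` — Peter–Weyl containment.** A bi-invariant `J` consists of representative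
functions of the Wedderburn blocks whose characters it contains: `J ≤ repFun {i : χᵢ ∈ J}`
(from `stub_support`, contrapositively, and `stub_expansion`). -/
theorem le_repFun_charSupport [Fintype G] [∀ i, NeZero (d i)]
    (φ : MonoidAlgebra ℂ G ≃ₐ[ℂ] BlockAlgebraC d) (J : Submodule ℂ (G → ℂ))
    (hJ : ∀ f ∈ J, ∀ a b : G, (fun g : G => f (a * g * b)) ∈ J) :
    J ≤ repFun (fun i : {i : Fin r // (blockRep φ i).character ∈ J} => d i.1)
      (fun i => ((((Pi.evalAlgHom ℂ (fun j : Fin r => Matrix (Fin (d j)) (Fin (d j)) ℂ) i.1).comp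
        φ.toAlgHom).toMonoidHom).comp (MonoidAlgebra.of ℂ G)).toHomUnits) := by
  intro f hf
  refine stub_expansion φ (fun i => (blockRep φ i).character ∈ J) f fun i hi => ?_
  by_contra hne
  exact hi (stub_support φ J hJ hf hne)

/-- **`GradedPricing` (crux `stmt-MatrixMultiplication-7611`, route `LevelGradedCohnUmans`) — the
finite-group `R_sep` form of Blasiak–Cohn–Grochow–Pratt–Umans 2024, Thm 2.2.**  For a finite group
`G`, a bi-invariant `J ≤ ℂ^G` and a `J`-separated triple `X, Y, Z ⊆ G`,
`(|X||Y||Z|)^(ω/3) ≤ Σᶠ_{χ ∈ Irr(G) ∩ J} χ(1)^ω`.  Composition of the line `fourier-support-repfun`: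
`sep_inv_dictionary` + `le_repFun_charSupport` feed the tree's `BCGPU2024_thm_2_2_corrected_holds`
on `(X⁻¹, Y⁻¹, Z⁻¹)` with `R_sep := {i // χᵢ ∈ J}`; `Finset.card_inv`; `sum_charSupport_rpow_le` at
`s = ω`.  The zero-volume corner (in particular `Y = ∅`) is `0^(ω/3) = 0 ≤ Σᶠ ≥ 0`. -/
theorem GradedPricing_of :
    Summit.MatrixMultiplication.MatrixMultiplication.Theses.LevelGradedCohnUmans.GradedPricing := by
  intro G _ _ J hJ X Y Z hsep
  have hω0 : 0 < omega ℂ := zero_lt_two.trans_le (omega_two_le (K := ℂ))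
  have hfin : (irrChars G ∩ (J : Set (G → ℂ))).Finite :=
    (irrChars_finite_holds G).subset Set.inter_subset_left
  rcases Nat.eq_zero_or_pos (X.card * Y.card * Z.card) with hq | hq
  · -- zero volume: `0 ≤ Σᶠ`
    rw [hq, Nat.cast_zero, Real.zero_rpow (div_pos hω0 three_pos).ne',
      finsum_mem_eq_finite_toFinset_sum _ hfin]
    exact Finset.sum_nonneg fun ψ hψ => by
      obtain ⟨n, -, hn⟩ := IsIrrChar.exists_apply_one (hfin.mem_toFinset.1 hψ).1
      rw [hn]
      exact Real.rpow_nonneg (by simp) _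
  · have hY : Y.Nonempty := Finset.card_pos.1 (Nat.pos_of_ne_zero fun h => by simp [h] at hq)
    obtain ⟨r, d, hd, ⟨φ⟩⟩ := exists_algEquiv_pi_matrix G
    haveI := hd
    obtain ⟨hTPP, fsep, hfsep, hmemJ⟩ := sep_inv_dictionary J X Y Z hY hsep
    have hmem : ∀ x ∈ X⁻¹, ∀ z ∈ Z⁻¹, fsep x z ∈
        repFun (fun i : {i : Fin r // (blockRep φ i).character ∈ J} => d i.1)
          (fun i => ((((Pi.evalAlgHom ℂ (fun j : Fin r => Matrix (Fin (d j)) (Fin (d j)) ℂ) i.1).comp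
            φ.toAlgHom).toMonoidHom).comp (MonoidAlgebra.of ℂ G)).toHomUnits) :=
      fun x hx z hz => le_repFun_charSupport φ J hJ (hmemJ x hx z hz)
    have key := BCGPU2024_thm_2_2_corrected_holds G X⁻¹ Y⁻¹ Z⁻¹ hTPP
      {i : Fin r // (blockRep φ i).character ∈ J} (fun i => d i.1)
      (fun i => ((((Pi.evalAlgHom ℂ (fun j : Fin r => Matrix (Fin (d j)) (Fin (d j)) ℂ) i.1).comp
        φ.toAlgHom).toMonoidHom).comp (MonoidAlgebra.of ℂ G)).toHomUnits) fsep hfsep hmem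
    rw [Finset.card_inv, Finset.card_inv, Finset.card_inv] at key
    exact key.trans (sum_charSupport_rpow_le φ J (omega ℂ))

end Summit.MatrixMultiplication.MatrixMultiplication.Theorems.GradedPricing

end
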